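import Summits.BirchSwinnertonDyer.BirchSwinnertonDyer.Theorems.ByReductionTypeAtTwoSupersingularFlatBlindLocalCount
import Summits.BirchSwinnertonDyer.BirchSwinnertonDyer.Theorems.ByReductionTypeAtTwoSupersingularFlatBlindHondaRungSharp
import Summits.BirchSwinnertonDyer.BirchSwinnertonDyer.Theorems.ByReductionTypeAtTwoSupersingularFlatBlindTwistedInfRes
import HarnessLib

/-!
# Route `ByReductionTypeAtTwo` (rung K4), crux `SupersingularRankZeroAtTwo` (item stmt-BirchSwinnertonDyer-19097), line
# `odd_blind_package` (registry v2.10.1), slot 5 `stub_CD` = CDC_H, hand h9 = HT-C7locE = (hE), FIRST CONJUNCT (T):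
# **THE ♭-LINE IS TRANSVERSAL TO THE LAYER-1 ANTI-INVARIANT KUMMER CLASSES AT `v ∣ 2` — AT EVERY LEVEL `J`**
# (cell `bsd-2adic`, seat `bsd-2adic-tower-1` GEN 62; pen SUMMON 20260831T085936Z; consumer ★★ p816496
# `…FlatBlindCardPositionLocal.lean` :111 `lineComplement_of_transversal_of_lineCard`, binder `hE`, conjunct 1)

HONEST FRAMING: THEOREMS ONLY (no definition, no named fact, no instance, no `sorry`); a helper `--supports 19097`; it proves the
TRANSVERSALITY conjunct (T) of the hand (hE) for EVERY level `J` (so any `J₃` serves), NOT the line bound (C) `2^J ≤ #L^E_J`, NOT CDC_H,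
NOT the crux; nothing is booked (D-0054); BSD is proved for no curve by any of this. bears_on: K4 (19097).

## What is proved

* §1 (generic base: any `K` of characteristic `0`, `p = 2`, `u = −1`, completion `E`, NO `2`-torsion in the tower `E(K_∞·K_v)`, any set of
  functionals `𝒦`, any `g ∈ Γ_E`) `flat_inf_kummerLine_eq_bot_of_sharp`: the SHARP pointwise transversality «every `ψ₂`-vector `y` of layer `1`
  outside `2^k·E(K_1·K_v)` has a `z ∈ 𝒦` with `2^k ∤ z(y)`» forces
  `L♭_J ⊓ K_J = ⊥` in `H¹(Γ_E, E[2^J](ψ₂))`, where `L♭_J = twistedSharpFlatLocalKummer 2 κ J (−1) _ E (E(K_∞·K_v)) 𝒦` (Sprung's annihilator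
  condition, Def. 7.9) and `K_J = twistedTorsionLocalKummer 2 κ J (−1) _ E (E(K_1·K_v) ⊓ ker (g+1))` (Kummer classes of layer-`1` points killed
  by `g + 1`).  Proof = HT-1 (★ p-LocalCount `finite_and_natCard_flat_inf_kummerLine_le_pow`) with the exponent sharpened by one: a class of the
  intersection is `∂Q'` on `Gal(K̄_E/(K_∞)_w)` with `x = 2^{N+1}Q'` a `ψ₂`-vector of layer `1` annihilated to order `2^{N+1}` by `𝒦` (the ♭
  representative differs by a tower point and a `2^J`-torsion point); the sharp hypothesis forces `x = 2^{N+1} w`, `w ∈ E(K_1·K_v)`, so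
  `Q' = w + D` with `2^{N+1} D = 0`, and the class equals the class of the ZERO cocycle (`oneCocycleClass_eq_of_kummer_congr`, ★ p-LocalKummerCongruence).
* §2 (over `ℚ`, `v ∋ 2`, `GoodSS W 2`, a Honda system at two carried by `(g, c)`) `sharp_pointwise_transversality_of_isHondaSystemAtTwo`: the sharp
  pointwise transversality for `𝒦 = Ker Col♭` — the generic chain of ★★ p812594 (`…HondaRungSharp.lean`), WITHOUT its idle binders
  (`¬CM`, `a₂ ≠ 0`, odd sign, `γ`): Silverman VII.6.3 at layer `1` ⟹ non-degenerate pair ⟹ (IND₁) ⟹ odd Wronskian slope ⟹ (K₄) ⟹ (Y″);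
  and ★★ `HTC7locE_flatLine_inf_layerOneKummer_eq_bot`: **conjunct (T) of (hE), binders VERBATIM, for EVERY `J`** (after
  `twistedSharpFlatLocalFamily_self`).  Kobayashi's blind spot at layer `1`: `E(k₁)^{σ=−1} ∩ E^♭ = 0` modulo `2^J`-divisibility.

References: [Sprung2012] F. Sprung, J. Number Theory 132 (2012), Thm. 2.2, Lemma 2.3 (p. 1487), Def. 7.9 / 7.11 (p. 1503); [Kobayashi2003]
S. Kobayashi, Invent. math. 152 (2003), §8 (Prop. 8.12); [GreenbergLNM1716] §3, §4 pp. 122–124; [SilvermanAEC2009] VII Prop. 6.3.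
-/

set_option autoImplicit false
set_option linter.dupNamespace false

noncomputable section

open scoped Classical NumberField

universe u

namespace Summit.BirchSwinnertonDyer.BirchSwinnertonDyer.Theorems

namespace OddBlindLocal

open NumberField IsDedekindDomain Field WeierstrassCurve Literature.NumberTheory.EllipticCurves
  Literature.NumberTheory.GaloisRepresentations Literature.NumberTheory.GaloisCohomology ZpExtension
  Literature.NumberTheory.EllipticCurves.Kobayashi2003 Literature.NumberTheory.EllipticCurves.Sprung2017
  Literature.NumberTheory.EllipticCurves.Sprung2012 Literature.NumberTheory.EllipticCurves.Rank1Residual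
  Summit.BirchSwinnertonDyer.Rank1Residual.F1Sign2
  CategoryTheory ContinuousCohomology TopRep ContRepresentation

/-! ## §1 Generic base: sharp pointwise transversality ⟹ `L♭_J ⊓ K_J = ⊥` -/

section Generic

variable {K : Type u} [Field K] [CharZero K] (W : WeierstrassCurve K) [W.IsElliptic]
  (κ : ZpExtension K 2) (J : ℕ) (hu : ((2 : ℕ) : ℤ) ∣ (-1 : ℤ) - 1)
  (E : Type u) [Field E] [Algebra K E]

/-- ★ **(T), generic form (`p = 2`, `u = −1`, any base, any level `J`).** At a completion `E` of `K` where the tower `E(K_∞·K_v)` has no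
`2`-torsion, let `𝒦` be any set of functionals on `E(K_∞·K_v)` (meant: `Ker Col♭`), `g ∈ Γ_E` (meant: a lift of the topological generator),
and suppose the SHARP pointwise transversality: every `ψ₂`-vector `y` of layer `1` (`g•y = −y`) outside `2^k·E(K_1·K_v)` has a `z ∈ 𝒦` with
`2^k ∤ z(y)`.  Then Sprung's ♭ condition `L♭_J = twistedSharpFlatLocalKummer 2 κ J (−1) _ E (E(K_∞·K_v)) 𝒦` meets the Kummer classes of the
layer-`1` anti-invariant points `K_J = twistedTorsionLocalKummer 2 κ J (−1) _ E (E(K_1·K_v) ⊓ ker (g+1))` only in `0`.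
Proof: as HT-1 with one more power of `2` — a common class is `∂Q'` on `Gal(K̄_E/(K_∞)_w)` with `x = 2^{N+1}Q'` a `ψ₂`-vector of layer `1`
annihilated to order `2^{N+1}` by `𝒦`, so `x = 2^{N+1} w` with `w` of layer `1`, `Q' − w` is `2^{N+1}`-torsion, and the class is that of the zero
cocycle (`oneCocycleClass_eq_of_kummer_congr`). [cite: Sprung2012, Def. 7.9 and Def. 7.11 (p. 1503)] [cite: GreenbergLNM1716, §3, §4 pp. 122–124] -/
theorem flat_inf_kummerLine_eq_bot_of_sharp
    (hnt : ∀ P ∈ localTowerPointsOfEmb κ (closureEmb (K := K) E) W, 2 • P = 0 → P = 0)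
    (g : absoluteGaloisGroup E) (𝒦 : Set (↥(localTowerPointsOfEmb κ (closureEmb (K := K) E) W) →+ ℤ_[2]))
    (hsharp : ∀ (y : localPoints W E) (hy : y ∈ localLayerPointsOfEmb κ (closureEmb (K := K) E) W 1), g • y = -y →
      ∀ k : ℕ, (∀ w ∈ localLayerPointsOfEmb κ (closureEmb (K := K) E) W 1, 2 ^ k • w ≠ y) →
        ∃ z ∈ 𝒦, ¬ (2 : ℤ_[2]) ^ k ∣
          z ⟨y, localLayerPointsOfEmb_le_localTowerPointsOfEmb κ (closureEmb (K := K) E) W 1 hy⟩) :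
    W.twistedSharpFlatLocalKummer 2 κ J (-1) hu E (localTowerPointsOfEmb κ (closureEmb (K := K) E) W) 𝒦 ⊓
      W.twistedTorsionLocalKummer 2 κ J (-1) hu E (localLayerPointsOfEmb κ (closureEmb (K := K) E) W 1 ⊓
        (DistribSMul.toAddMonoidHom (localPoints W E) g + AddMonoidHom.id _).ker) = ⊥ := by
  have hle1 := localLayerPointsOfEmb_le_localTowerPointsOfEmb κ (closureEmb (K := K) E) W 1
  rw [eq_bot_iff]
  rintro y ⟨⟨ψ, Q, k, hQT, hyψ, hdiv, hτ⟩, ⟨ψ', Q', k', hyψ', hA, hτ'⟩⟩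
  -- `ψ − ψ'` is principal with vector `m`
  have h0 : oneCocycleClass _ (ψ - ψ') = 0 := by rw [oneCocycleClass_sub, hyψ, hyψ', sub_self]
  obtain ⟨m, hm⟩ := (oneCocycleClass_eq_zero_iff _ _).1 h0
  -- `Q − Q' − ι(m)` is a tower point
  have hR : Q - Q' - pointsMap W E ((m : W.geomTorsion ((2 ^ J : ℕ) : ℤ)) : W.geomPoints) ∈
      localTowerPointsOfEmb κ (closureEmb (K := K) E) W := by
    rw [mem_localTowerPointsOfEmb_iff]
    intro τ hτmem
    have e3 : pointsMap W E (((ψ - ψ').1 τ : W.geomTorsion ((2 ^ J : ℕ) : ℤ)) : W.geomPoints) =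
        τ • pointsMap W E ((m : W.geomTorsion ((2 ^ J : ℕ) : ℤ)) : W.geomPoints) -
          pointsMap W E ((m : W.geomTorsion ((2 ^ J : ℕ) : ℤ)) : W.geomPoints) := by
      rw [hm τ, AddSubgroupClass.coe_sub, map_sub, pointsMap_twisted_rho_of_mem_localSubgroup W 2 κ J (-1) hu E hτmem m]
    rw [Submodule.coe_sub, ContinuousMap.sub_apply, AddSubgroupClass.coe_sub, map_sub, hτ ⟨τ, hτmem⟩,
      hτ' ⟨τ, hτmem⟩] at e3
    have e4 : τ • Q - τ • Q' = Q - Q' + (τ • pointsMap W E ((m : W.geomTorsion ((2 ^ J : ℕ) : ℤ)) : W.geomPoints) -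
        pointsMap W E ((m : W.geomTorsion ((2 ^ J : ℕ) : ℤ)) : W.geomPoints)) := by
      rw [← e3]; abel
    rw [smul_sub, smul_sub, e4]
    abel
  -- `x := 2^(N+1) • Q'` (`N = k + k' + J`) is a `ψ₂`-vector of layer `1`
  have hxA : 2 ^ (k + k' + J + 1) • Q' ∈ localLayerPointsOfEmb κ (closureEmb (K := K) E) W 1 ⊓
      (DistribSMul.toAddMonoidHom (localPoints W E) g + AddMonoidHom.id _).ker := by
    have h : 2 ^ (k + k' + J + 1) • Q' = 2 ^ (k + J + 1) • (2 ^ k' • Q') := by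
      rw [← mul_smul, ← pow_add]; congr 1; ring
    rw [h]; exact AddSubgroup.nsmul_mem _ hA _
  have hxM : 2 ^ (k + k' + J + 1) • Q' ∈ localLayerPointsOfEmb κ (closureEmb (K := K) E) W 1 := hxA.1
  have hgx : g • (2 ^ (k + k' + J + 1) • Q') = -(2 ^ (k + k' + J + 1) • Q' : localPoints W E) := by
    have h : (DistribSMul.toAddMonoidHom (localPoints W E) g + AddMonoidHom.id (localPoints W E) :
        localPoints W E →+ localPoints W E) (2 ^ (k + k' + J + 1) • Q') = 0 := hxA.2
    rw [AddMonoidHom.add_apply, DistribSMul.toAddMonoidHom_apply, AddMonoidHom.id_apply] at h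
    exact eq_neg_of_add_eq_zero_left h
  -- `z(x)` is divisible by `2^(N+1)` for `z ∈ 𝒦`
  have hDm0 : 2 ^ (k + k' + J + 1) • pointsMap W E ((m : W.geomTorsion ((2 ^ J : ℕ) : ℤ)) : W.geomPoints) = 0 := by
    rw [show k + k' + J + 1 = (k + k' + 1) + J by ring, pow_add, mul_smul, ← map_nsmul (pointsMap W E) (2 ^ J),
      ← AddSubgroupClass.coe_nsmul, W.pow_nsmul_geomTorsion_pow 2 J, ZeroMemClass.coe_zero, map_zero, smul_zero]
  have hdivx : ∀ z ∈ 𝒦, (2 : ℤ_[2]) ^ (k + k' + J + 1) ∣ z ⟨2 ^ (k + k' + J + 1) • Q', hle1 hxM⟩ := by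
    intro z hz
    have hsub : (⟨2 ^ (k + k' + J + 1) • Q', hle1 hxM⟩ : ↥(localTowerPointsOfEmb κ (closureEmb (K := K) E) W)) =
        2 ^ (k' + J + 1) • ⟨2 ^ k • Q, hQT⟩ - 2 ^ (k + k' + J + 1) • ⟨_, hR⟩ := by
      apply Subtype.ext
      rw [AddSubgroupClass.coe_sub, AddSubgroupClass.coe_nsmul, AddSubgroupClass.coe_nsmul, ← mul_smul, ← pow_add,
        show k' + J + 1 + k = k + k' + J + 1 by ring, smul_sub, smul_sub, hDm0, sub_zero, sub_sub_cancel]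
    rw [hsub, map_sub, map_nsmul, map_nsmul]
    refine dvd_sub ?_ ?_
    · obtain ⟨t, ht⟩ := hdiv z hz
      rw [ht, nsmul_eq_mul, Nat.cast_pow, Nat.cast_ofNat, ← mul_assoc, ← pow_add,
        show k' + J + 1 + k = k + k' + J + 1 by ring]
      exact dvd_mul_right _ _
    · rw [nsmul_eq_mul, Nat.cast_pow, Nat.cast_ofNat]
      exact dvd_mul_right _ _
  -- the SHARP hypothesis (contrapositive): `x = 2^(N+1) • w` with `w ∈ E(K_1·K_v)`
  have hw : ∃ w ∈ localLayerPointsOfEmb κ (closureEmb (K := K) E) W 1,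
      2 ^ (k + k' + J + 1) • w = 2 ^ (k + k' + J + 1) • Q' := by
    by_contra hcon
    simp only [not_exists, not_and] at hcon
    obtain ⟨z, hz, hndvd⟩ := hsharp _ hxM hgx (k + k' + J + 1) hcon
    exact hndvd (hdivx z hz)
  obtain ⟨w, hwM, hw⟩ := hw
  -- `Q' = w + D` with `2^(N+1) D = 0`: the class is that of the zero cocycle
  rw [AddSubgroup.mem_bot, ← hyψ']
  refine (oneCocycleClass_eq_of_kummer_congr W 2 κ J (-1) hu E hnt ψ' 0 (Q₂ := 0) hτ' (fun τ ↦ ?_)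
    (hle1 hwM) (N := k + k' + J + 1) (D := Q' - w) ?_ (by abel)).trans (oneCocycleClass_zero _)
  · rw [Submodule.coe_zero, ContinuousMap.zero_apply, ZeroMemClass.coe_zero, map_zero, smul_zero, sub_zero]
  · rw [smul_sub, ← hw, sub_self]

end Generic

/-! ## §2 Over `ℚ` at `v ∋ 2`: the sharp pointwise transversality from a Honda system at two, and conjunct (T) of (hE) -/

section Rat

/-- **Sharp pointwise transversality of `Ker Col♭` for a Honda system at two** (the generic chain of ★★ p812594
`flatBlindLocalTransversalityHondaOffZeroAtTwo_sharp`, stated without its idle binders): for `W/ℚ` globally minimal with `GoodSS W 2`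
(`a₂ ∈ {0, ±2}`), any `ℤ₂`-extension `κ`, `v ∋ 2`, a local lift `g` of a topological generator and the `c`-part of a Honda system at two,
every `ψ₂`-vector `y ∈ E(ℚ_{1,v})` (`g•y = −y`) outside `2^k·E(ℚ_{1,v})` has a `z ∈ Ker Col♭` with `2^k ∤ z(y)`.  Silverman VII.6.3 at layer `1`
(`silvermanVII63_localLayerPoints_finiteIndex_zpLattice_holds`) ⟹ non-degenerate pair (`exists_nondegeneratePair_of_lattice`) ⟹ (IND₁)
(`independent_of_nondegeneratePair`) ⟹ odd Wronskian slope (`exists_oddSlope_of_independent`) ⟹ (K₄)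
(`exists_mem_colemanKer_flat_not_four_dvd_of_odd_slope`) ⟹ (Y″) (`not_pow_dvd_apply_of_not_four_dvd`).
[cite: Sprung2012, Thm. 2.2, Lemma 2.3 (p. 1487), Def. 7.9 (p. 1503)] [cite: SilvermanAEC2009, VII Prop. 6.3] -/
theorem sharp_pointwise_transversality_of_isHondaSystemAtTwo (W : WeierstrassCurve ℚ) [W.IsElliptic] [W.IsGloballyMinimal]
    (hss : GoodSS W 2) (κ : ZpExtension ℚ 2) {v : HeightOneSpectrum (𝓞 ℚ)} (hv : (2 : 𝓞 ℚ) ∈ v.asIdeal)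
    {g : absoluteGaloisGroup (v.adicCompletion ℚ)} {cneg : localPoints W (v.adicCompletion ℚ)}
    {c : ℕ → localPoints W (v.adicCompletion ℚ)}
    (hg : κ.IsTopGenerator (resGalOfEmb (closureEmb (K := ℚ) (v.adicCompletion ℚ)) g))
    (hH : IsHondaSystemAtTwo κ (closureEmb (K := ℚ) (v.adicCompletion ℚ)) W (W.frobeniusTrace 2) g cneg c) :
    ∀ (y : localPoints W (v.adicCompletion ℚ))
      (hy : y ∈ localLayerPointsOfEmb κ (closureEmb (K := ℚ) (v.adicCompletion ℚ)) W 1), g • y = -y →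
      ∀ k : ℕ, (∀ w ∈ localLayerPointsOfEmb κ (closureEmb (K := ℚ) (v.adicCompletion ℚ)) W 1, 2 ^ k • w ≠ y) →
        ∃ z ∈ colemanKer κ (closureEmb (K := ℚ) (v.adicCompletion ℚ)) W (W.frobeniusTrace 2) g c .flat,
          ¬ (2 : ℤ_[2]) ^ k ∣
            z ⟨y, localLayerPointsOfEmb_le_localTowerPointsOfEmb κ (closureEmb (K := ℚ) (v.adicCompletion ℚ)) W 1 hy⟩ := by
  intro y hy hgy k hndiv
  have hv' : ((2 : ℕ) : 𝓞 ℚ) ∈ v.asIdeal := by exact_mod_cast hv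
  have hnt := SignedKatoOffTwo.SignedIntersection.noTwoTorsion_localTowerPointsOfEmb_adicCompletion W hss κ v hv
    (closureEmb (K := ℚ) (v.adicCompletion ℚ))
  -- (IND₁) from the layer-one lattice
  obtain ⟨H, hHle, hfin, hφ⟩ := silvermanVII63_localLayerPoints_finiteIndex_zpLattice.rat
    silvermanVII63_localLayerPoints_finiteIndex_zpLattice_holds κ hv' (closureEmb (K := ℚ) (v.adicCompletion ℚ)) W 1
  rw [index_localLayerSubgroupOfEmb_eq_pow_of_isTopGenerator κ (closureEmb (K := ℚ) (v.adicCompletion ℚ)) hg 1, pow_one] at hφ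
  obtain ⟨φ⟩ := hφ
  have hind := independent_of_nondegeneratePair hnt hss.2 hg hH (exists_nondegeneratePair_of_lattice hHle hfin φ)
  -- (D₁): odd Wronskian slope; (K₄); (Y″)
  obtain ⟨z₀, z₁, a₀, b₀, a₁, b₁, h₀, h₁, hodd⟩ := exists_oddSlope_of_independent hnt hss.2 hg hH hind
  obtain ⟨z, hzK, hz4⟩ := exists_mem_colemanKer_flat_not_four_dvd_of_odd_slope hg hH h₀ h₁ hodd
  exact ⟨z, hzK, not_pow_dvd_apply_of_not_four_dvd hnt hg hH z hz4 hy hgy hndiv⟩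

/-- ★★ **Conjunct (T) of the hand (hE) = HT-C7locE, binders VERBATIM, at EVERY level `J`.**  For `W/ℚ` globally minimal with `GoodSS W 2`,
`κ` cyclotomic, `v ∋ 2`, local data `(g, c)` carrying a Honda system at two: the ♭-LINE
`L^E_J = twistedSharpFlatLocalFamily 2 κ J (−1) _ v (E((ℚ_∞)_w)) (Ker Col♭) v` meets the twisted Kummer classes of the layer-`1` points killed by
`g + 1` ONLY IN `0` — Kobayashi's blind spot at layer `1` (`E(k₁)^{σ=−1} ∩ E^♭ = 0` modulo `2^J`-divisibility): the sharp pointwise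
transversality of the Honda system (`sharp_pointwise_transversality_of_isHondaSystemAtTwo`) fed into §1.  The hypotheses `hκ`, `hc`, `htr`,
`hz₀`, `hsat` are carried for the consumer's shape and not used (`hH` contains them).
[cite: Kobayashi2003, §8 Prop. 8.12] [cite: Sprung2012, Def. 7.9 and Def. 7.11 (p. 1503)] [cite: GreenbergLNM1716, §4 pp. 122–124] -/
theorem HTC7locE_flatLine_inf_layerOneKummer_eq_bot :
    ∀ (W : WeierstrassCurve ℚ) [W.IsElliptic] [W.IsGloballyMinimal], GoodSS W 2 →
      ∀ (κ : ZpExtension ℚ 2), κ.IsCyclotomic →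
      ∀ (v : HeightOneSpectrum (𝓞 ℚ)), (2 : 𝓞 ℚ) ∈ v.asIdeal →
      ∀ (g : Field.absoluteGaloisGroup (v.adicCompletion ℚ)) (c : ℕ → localPoints W (v.adicCompletion ℚ)),
        κ.IsTopGenerator (resGalOfEmb (closureEmb (K := ℚ) (v.adicCompletion ℚ)) g) →
        (∀ n, c n ∈ localLayerPointsOfEmb κ (closureEmb (K := ℚ) (v.adicCompletion ℚ)) W n) →
        (∀ n, 1 ≤ n → localTraceOfEmb κ (closureEmb (K := ℚ) (v.adicCompletion ℚ)) W n (n + 1)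
          (c (n + 1)) = W.frobeniusTrace 2 • c n - c (n - 1)) →
        (∀ z₀ : localLayerPointsOfEmb κ (closureEmb (K := ℚ) (v.adicCompletion ℚ)) W 0 →+ ℤ_[2],
          evalOn W (localLayerPointsOfEmb κ (closureEmb (K := ℚ) (v.adicCompletion ℚ)) W 0) z₀ (c 0) = 0 → z₀ = 0) →
        (∀ a : ℤ_[2],
          (∃ z₀ : localLayerPointsOfEmb κ (closureEmb (K := ℚ) (v.adicCompletion ℚ)) W 0 →+ ℤ_[2],
            evalOn W (localLayerPointsOfEmb κ (closureEmb (K := ℚ) (v.adicCompletion ℚ)) W 0) z₀ (c 0) = 2 * a) →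
          ∃ y : localLayerPointsOfEmb κ (closureEmb (K := ℚ) (v.adicCompletion ℚ)) W 0 →+ ℤ_[2],
            evalOn W (localLayerPointsOfEmb κ (closureEmb (K := ℚ) (v.adicCompletion ℚ)) W 0) y (c 0) = a) →
        (∃ cneg : localPoints W (v.adicCompletion ℚ),
          Summit.BirchSwinnertonDyer.Rank1Residual.F1Sign2.IsHondaSystemAtTwo κ (closureEmb (K := ℚ) (v.adicCompletion ℚ)) W
            (W.frobeniusTrace 2) g cneg c) →
      ∀ J : ℕ,
        W.twistedSharpFlatLocalFamily 2 κ J (-1) OddBlindTwist.two_dvd_neg_one_sub_one v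
            (localTowerPointsOfEmb κ (closureEmb (K := ℚ) (v.adicCompletion ℚ)) W)
            (colemanKer κ (closureEmb (K := ℚ) (v.adicCompletion ℚ)) W (W.frobeniusTrace 2) g c .flat) v ⊓
          W.twistedTorsionLocalKummer 2 κ J (-1) OddBlindTwist.two_dvd_neg_one_sub_one (v.adicCompletion ℚ)
            (localLayerPointsOfEmb κ (closureEmb (K := ℚ) (v.adicCompletion ℚ)) W 1 ⊓
              (DistribSMul.toAddMonoidHom (localPoints W (v.adicCompletion ℚ)) g + AddMonoidHom.id _).ker) = ⊥ := by
  intro W _ _ hss κ _hκ v hv g c hg _hc _htr _hz _hsat hH J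
  obtain ⟨cneg, hH⟩ := hH
  rw [twistedSharpFlatLocalFamily_self]
  exact flat_inf_kummerLine_eq_bot_of_sharp W κ J OddBlindTwist.two_dvd_neg_one_sub_one (v.adicCompletion ℚ)
    (SignedKatoOffTwo.SignedIntersection.noTwoTorsion_localTowerPointsOfEmb_adicCompletion W hss κ v hv _) g _
    (sharp_pointwise_transversality_of_isHondaSystemAtTwo W hss κ hv hg hH)

end Rat

end OddBlindLocal

end Summit.BirchSwinnertonDyer.BirchSwinnertonDyer.Theorems

end
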